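import Summits.AnomalousDissipation.AnomalousDissipation.Theorems.MarginalStabilityChainStrainedLayerLawClockEnergyRelaminarisation
import Summits.AnomalousDissipation.AnomalousDissipation.Theorems.MarginalStabilityChainStrainedLayerLawClockLaminarMeanOfEnergyDecay
import HarnessLib

/-!
# Crux `MarginalStabilityChain.StrainedLayerLaw` (stmt-AnomalousDissipation-3007), line `FirstLemmasR2K4`:
# no tailed witness of the law in the energy-stable regime

Support file (`--supports stmt-AnomalousDissipation-3007`; registered sub-goal `law_fails_of_energyStable`, lead c7). Composition of
the two landed wave-4 theorems: `energy_relaminarisation` (global nonlinear energy stability of the Burgers layer in the tailed class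
when `L²(3πν + 2) ≤ 16π³ν²`: perturbation energy `≤ e^{−(t−s)/2}`, gradient budget) and `meanLayerDissipation_laminar_of_energyDecay`
(then the long-time mean dissipation is EXACTLY the laminar Sweet–Parker value `√ν/(2√π)`). Consequence recorded here: at such an
ENERGY-STABLE pair `(ν, L)` every member of the crux's class with locally finite dissipation and shear tails on compact windows has
mean dissipation equal to the laminar value, so it cannot witness ANY floor above `√ν/(2√π)` — for every datum `θ`, however large
or `x`-dependent. In the crux's normalisation this bites exactly when `c·min L 1 > √ν/(2√π)` at an energy-stable pair; since the
energy-stable window is `L ≤ 4π^{3/2}ν/√(3πν + 2)` (`≈ 15.7ν` for small `ν`), that needs `c ≳ 0.018/√ν`, i.e. it constrains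
large floors / moderate `ν` only (e.g. `ν = 0.2`, `L ∈ [1, 2.2]`, `c > 0.13`). The content of the package is the exact laminar
mean in the energy-stable regime (the nonlinear companion of the route's `BurgersLayerLowRe`), not a bound on the crux's `c`.
No facts are asserted.
-/

-- `Summit.<Summit>.<Problem>` is the tree's mandated summit-side namespace (CONVENTIONS §2); for this
-- single-conjunct summit the two coincide, so the duplicate is deliberate.
set_option linter.dupNamespace false

noncomputable section

open scoped Topology ENNReal
open Filter Set Function MeasureTheory

namespace Summit.AnomalousDissipation.AnomalousDissipation.Theorems.StrainedLayerLaw.LogEnstrophyClock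

open Literature.Analysis.FluidPDE Literature.Analysis.FluidPDE.StretchedLayer
open Summit.AnomalousDissipation.AnomalousDissipation.Theses.MarginalStabilityChain
open Summit.AnomalousDissipation.AnomalousDissipation.Theorems.StrainedLayerLaw.StrainWorkSumRule

/-- **Mean dissipation is laminar in the energy-stable regime.** For `0 < ν`, `0 < L` with `L²(3πν + 2) ≤ 16π³ν²`, every
classical solution of the stretched layer class on `(0, ∞)` with shear tails on compact windows and locally finite dissipation has
`meanLayerDissipation ν L u v = ofReal (√ν/(2√π))` (`energy_relaminarisation` fed into `meanLayerDissipation_laminar_of_energyDecay`).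
[folklore] -/
theorem meanLayerDissipation_eq_laminar_of_energyStable {ν L : ℝ} (hν : 0 < ν) (hL : 0 < L)
    (hE : L ^ 2 * (3 * Real.pi * ν + 2) ≤ 16 * Real.pi ^ 3 * ν ^ 2) {u v p : ℝ → ℝ → ℝ → ℝ}
    (hsol : IsStretchedLayerNSSolutionOn (Ioi 0) ν 1 1 L u v p)
    (htails : ∀ a b : ℝ, 0 < a → a < b → ExpTails (Icc a b) u v)
    (hfin : ∀ T : ℝ, 0 < T → ∫⁻ t in Ioc 0 T, layerDissipation ν L (u t) (v t) ≠ ∞) :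
    meanLayerDissipation ν L u v = ENNReal.ofReal (Real.sqrt ν / (2 * Real.sqrt Real.pi)) :=
  meanLayerDissipation_laminar_of_energyDecay ν L hν hL u v p hsol htails hfin
    (energy_relaminarisation ν L hν hL hE u v p hsol htails)

/-- **No tailed witness of the law in the energy-stable regime (registered sub-goal `law_fails_of_energyStable`).** For
`0 < ν`, `0 < L` with `L²(3πν + 2) ≤ 16π³ν²` and `√ν/(2√π) < c·min L 1`, NO member of the crux's class `InCruxClass ν L θ₁ θ₂`
(any `θ`, admissible or not) with locally finite dissipation and shear tails on compact windows satisfies the floor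
`ofReal (c·min L 1) ≤ meanLayerDissipation ν L u v`: its mean dissipation is the laminar value (bites when the floor exceeds the
laminar value at an energy-stable pair, see the module docstring). [folklore] -/
theorem law_fails_of_energyStable : ∀ (ν L c : ℝ), 0 < ν → 0 < L →
    L ^ 2 * (3 * Real.pi * ν + 2) ≤ 16 * Real.pi ^ 3 * ν ^ 2 →
    Real.sqrt ν / (2 * Real.sqrt Real.pi) < c * min L 1 →
    ∀ (θ₁ θ₂ : ℝ → ℝ → ℝ) (u v p : ℝ → ℝ → ℝ → ℝ), InCruxClass ν L θ₁ θ₂ u v p →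
      (∀ T : ℝ, 0 < T → ∫⁻ t in Ioc 0 T, layerDissipation ν L (u t) (v t) ≠ ∞) →
      (∀ a b : ℝ, 0 < a → a < b → ExpTails (Icc a b) u v) →
        ¬ ENNReal.ofReal (c * min L 1) ≤ meanLayerDissipation ν L u v := by
  intro ν L c hν hL hE hlt θ₁ θ₂ u v p hcl hfin htails hfloor
  have hsol : IsStretchedLayerNSSolutionOn (Ioi 0) ν 1 1 L u v p := hcl.isSolution
  rw [meanLayerDissipation_eq_laminar_of_energyStable hν hL hE hsol htails hfin] at hfloor
  have := (ENNReal.ofReal_le_ofReal_iff (div_nonneg (Real.sqrt_nonneg _) (by positivity))).1 hfloor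
  exact absurd (lt_of_lt_of_le hlt this) (lt_irrefl _)

end Summit.AnomalousDissipation.AnomalousDissipation.Theorems.StrainedLayerLaw.LogEnstrophyClock

end
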